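import Summits.SmoothPoincare4.SmoothPoincare4.Theorems.ConvexBisectionAcyclicBisectionExistsTwistDiffeo
import Summits.SmoothPoincare4.SmoothPoincare4.Theorems.ConvexBisectionAcyclicBisectionExistsStabilisationCurvesRotate
import Summits.SmoothPoincare4.SmoothPoincare4.Theorems.ConvexBisectionAcyclicBisectionExistsChartedChainAssembly
import Summits.SmoothPoincare4.SmoothPoincare4.Theorems.ConvexBisectionAcyclicBisectionExistsChartCoreEmbedding
import HarnessLib

/-!
# Node N3a `node_STcurve` reduced to its one remaining geometric input — charted page curves in the
# classes `±e_j` (`1 ≤ j < g`) on the page of direction `1` — and PROVED for genus `1`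
(wave 6, brick G6-8 of stub `stub_STgeo` = NF4 N3, line `modp-braid-orbits`, crux
`ConvexBisection.AcyclicBisectionExists`, item stmt-SmoothPoincare4-10508; registered sub-goals
`helper_node_STcurve_of_eCurves`, `helper_STcurve_of_eCurves`, `helper_node_STcurve_genus_one`)

Assembly of the corrected route to N3a (report G6): the orbit theorem (`…PrimitiveOrbit.lean`), the
induction along the orbit (`…StabilisationCurves.lean`), the rigid page rotation
(`…StabilisationCurvesRotate.lean`), the page Dehn twist DIFFEOMORPHISM along any charted curve of
`page g 1` with its action on shadows (`…TwistDiffeo.lean`, node N1a) and Y4's charted chain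
(`helper_exists_charted_chain`, twist packages for all chain classes `chainVec g i`) leave exactly:

* (R-ECURVES) for `1 ≤ j < g` a charted page curve of `page g 1` (six clauses of node N1a) with shadow
  `e_j = Pi.single (inl j) 1` or `−e_j` (a transvection does not see the sign of its vector,
  `transvection_neg_eq`);
* (R-BASE) one smoothly embedded curve of `page g 1` with shadow `chainVec g 0` — PROVED here
  (`exists_embedded_baseCurve`: the core `b 0` of Y4's charted chain, a smooth embedding by
  `isSmoothEmbedding_core` of `…ChartCoreEmbedding.lean`);

so that **`node_STcurve_of_eCurves`** (registered `helper_node_STcurve_of_eCurves`; the version keeping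
(R-BASE) as a hypothesis is `stcurve_of_eCurves` / `helper_STcurve_of_eCurves`) proves the conclusion of
`node_STcurve` for every unit direction `d` and every primitive class from (R-ECURVES) alone, and
**`node_STcurve_genus_one`** (registered `helper_node_STcurve_genus_one`) proves node N3a outright for
`g = 1` (no `e_j` with `j ≥ 1`).  Everything is proved; no definitions, no named facts, no `sorry`.  Reference: B. Farb, D. Margalit, *A primer on mapping class
groups* (2012), Prop. 6.2, §4.4 (Humphries generators) [FarbMargalit2012]. [folklore]
-/

noncomputable section

set_option linter.dupNamespace false

open scoped Manifold ContDiff Topology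
open Set Function Metric
open Literature.Topology.FourManifolds Literature.Topology.FourManifolds.LefschetzBase
  Literature.GroupTheory.CombinatorialGroupTheory.SignedHurwitz

namespace Summit.SmoothPoincare4.SmoothPoincare4.Theorems.AcyclicBisectionExists.ModpBraidOrbits

variable {g : ℕ}

/-- **A signed transvection does not see the sign of its vector**: `T_{−a}^{s} = T_a^{s}`. [folklore] -/
theorem transvection_neg_eq (a : Fin g ⊕ Fin g → ℤ) (s : Bool) :
    transvection (stdSymp ℤ g) (-a, s) = transvection (stdSymp ℤ g) (a, s) := by
  refine LinearMap.ext fun y => ?_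
  rw [transvection_apply, transvection_apply]
  dsimp only
  rw [map_neg, LinearMap.neg_apply, mul_neg, neg_smul_neg]

/-- `chainVec g 0 = e_0` (`g ≥ 1`). [folklore] -/
theorem chainVec_zero_eq_single (hg : 1 ≤ g) : chainVec g 0 = Pi.single (Sum.inl (⟨0, hg⟩ : Fin g)) 1 := by
  have h := chainVec_even g ⟨0, hg⟩
  dsimp only at h
  rw [mul_zero, if_neg (lt_irrefl 0), sub_zero] at h
  exact h

/-- **Twist packages for the chain classes on the page of direction `1`** (Y4's charted chain and
`twistPackage_of_chart`). [cite: FarbMargalit2012, Prop. 6.3] -/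
theorem twistPackage_chainVec (g : ℕ) {i : ℕ} (hi : i < 2 * g) (s : Bool) :
    ∃ (τ : Base g → Base g) (hτ : Continuous τ), (∀ p ∈ page g 1, τ p ∈ page g 1) ∧
      (∀ K : Metric.sphere (0 : EuclideanSpace ℝ (Fin 2)) 1 → Base g,
        Manifold.IsSmoothEmbedding (𝓡 1) (𝓡∂ 4) ∞ K → (∀ θ, K θ ∈ page g 1) →
        Manifold.IsSmoothEmbedding (𝓡 1) (𝓡∂ 4) ∞ (τ ∘ K)) ∧
      (∀ (K : Metric.sphere (0 : EuclideanSpace ℝ (Fin 2)) 1 → Base g) (hK : Continuous K),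
        (∀ θ, K θ ∈ page g 1) →
        shadow g (τ ∘ K) (hτ.comp hK) = transvection (stdSymp ℤ g) (chainVec g i, s) (shadow g K hK)) := by
  obtain ⟨b, ψ, hb, hch, hsh, -, -⟩ := helper_exists_charted_chain g 1 norm_one
  obtain ⟨h1, h2, h3, h4, h5, h6⟩ := hch ⟨i, hi⟩
  rw [← hsh ⟨i, hi⟩]
  exact twistPackage_of_chart g s (ψ ⟨i, hi⟩) (b ⟨i, hi⟩) (hb ⟨i, hi⟩) h1 h2 h3 h4 h5 h6

/-- **A charted page curve of shadow `±a` gives a twist package for `a`.** [cite: FarbMargalit2012, Prop. 6.3] -/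
theorem twistPackage_of_chart_neg (g : ℕ) (s : Bool) (φ : ℝ × ℝ → Base g)
    (b : Metric.sphere (0 : EuclideanSpace ℝ (Fin 2)) 1 → Base g) (hb : Continuous b)
    (hφs : ContMDiff 𝓘(ℝ, ℝ × ℝ) (𝓡∂ 4) ∞ φ) (hφ1 : ∀ u r, φ (u + 1, r) = φ (u, r))
    (hφa : ∀ u, φ (u, 0) = b (circlePt u)) (hφp : ∀ p, φ p ∈ page g 1)
    (hφi : InjOn φ (Ico (0 : ℝ) 1 ×ˢ Ioo (-1 : ℝ) 1))
    (hφo : ∀ u r, r ∈ Ioo (-1 : ℝ) 1 →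
      0 < inner ℝ (deriv (fun r' => (φ (u, r')).1) r) (cplxJ (deriv (fun u' => (φ (u', r)).1) u)))
    (a : Fin g ⊕ Fin g → ℤ) (hsh : shadow g b hb = a ∨ shadow g b hb = -a) :
    ∃ (τ : Base g → Base g) (hτ : Continuous τ), (∀ p ∈ page g 1, τ p ∈ page g 1) ∧
      (∀ K : Metric.sphere (0 : EuclideanSpace ℝ (Fin 2)) 1 → Base g,
        Manifold.IsSmoothEmbedding (𝓡 1) (𝓡∂ 4) ∞ K → (∀ θ, K θ ∈ page g 1) →
        Manifold.IsSmoothEmbedding (𝓡 1) (𝓡∂ 4) ∞ (τ ∘ K)) ∧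
      (∀ (K : Metric.sphere (0 : EuclideanSpace ℝ (Fin 2)) 1 → Base g) (hK : Continuous K),
        (∀ θ, K θ ∈ page g 1) →
        shadow g (τ ∘ K) (hτ.comp hK) = transvection (stdSymp ℤ g) (a, s) (shadow g K hK)) := by
  obtain ⟨τ, hτ, h1, h2, h3⟩ := twistPackage_of_chart g s φ b hb hφs hφ1 hφa hφp hφi hφo
  refine ⟨τ, hτ, h1, h2, fun K hK hKc => ?_⟩
  rw [h3 K hK hKc]
  rcases hsh with h | h
  · rw [h]
  · rw [h, transvection_neg_eq]

/-- **N3a from (R-ECURVES) and (R-BASE).**  If for every `1 ≤ j < g` there is a charted page curve of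
`page g 1` with shadow `±e_j`, and some smoothly embedded curve of `page g 1` has shadow `chainVec g 0`,
then every primitive class is the shadow of a smoothly embedded curve of every flat open page
`page g d`, `‖d‖ = 1`. [cite: FarbMargalit2012, Prop. 6.2] -/
theorem stcurve_of_eCurves (g : ℕ)
    (hE : ∀ j : Fin g, 1 ≤ (j : ℕ) →
      ∃ (φ : ℝ × ℝ → Base g) (b : Metric.sphere (0 : EuclideanSpace ℝ (Fin 2)) 1 → Base g)
        (hb : Continuous b), ContMDiff 𝓘(ℝ, ℝ × ℝ) (𝓡∂ 4) ∞ φ ∧ (∀ u r, φ (u + 1, r) = φ (u, r)) ∧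
        (∀ u, φ (u, 0) = b (circlePt u)) ∧ (∀ p, φ p ∈ page g 1) ∧
        InjOn φ (Ico (0 : ℝ) 1 ×ˢ Ioo (-1 : ℝ) 1) ∧
        (∀ u r, r ∈ Ioo (-1 : ℝ) 1 →
          0 < inner ℝ (deriv (fun r' => (φ (u, r')).1) r) (cplxJ (deriv (fun u' => (φ (u', r)).1) u))) ∧
        (shadow g b hb = Pi.single (Sum.inl j) 1 ∨ shadow g b hb = -Pi.single (Sum.inl j) 1))
    (hbase : ∃ K₀ : Metric.sphere (0 : EuclideanSpace ℝ (Fin 2)) 1 → Base g,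
      Manifold.IsSmoothEmbedding (𝓡 1) (𝓡∂ 4) ∞ K₀ ∧ (∀ θ, K₀ θ ∈ page g 1) ∧
      ∃ hK₀ : Continuous K₀, shadow g K₀ hK₀ = chainVec g 0)
    {d : ℂ} (hd : ‖d‖ = 1) (v : Fin g ⊕ Fin g → ℤ) (hv : IsPrimitive v) :
    ∃ K : Metric.sphere (0 : EuclideanSpace ℝ (Fin 2)) 1 → Base g,
      Manifold.IsSmoothEmbedding (𝓡 1) (𝓡∂ 4) ∞ K ∧ (∀ θ, K θ ∈ page g d) ∧
      ∃ hK : Continuous K, shadow g K hK = v := by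
  refine stcurve_of_page_one g (stcurve_of_twists g 1 (fun a s ha => ?_) hbase) hd v hv
  rcases ha with ⟨i, hi, rfl⟩ | ⟨j, rfl⟩
  · exact twistPackage_chainVec g hi s
  · by_cases hj : 1 ≤ (j : ℕ)
    · obtain ⟨φ, b, hb, h1, h2, h3, h4, h5, h6, hsh⟩ := hE j hj
      exact twistPackage_of_chart_neg g s φ b hb h1 h2 h3 h4 h5 h6 _ hsh
    · have hg : 1 ≤ g := by have := j.2; omega
      have hj0 : j = ⟨0, hg⟩ := Fin.ext (by push Not at hj; show (j : ℕ) = 0; omega)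
      rw [hj0, ← chainVec_zero_eq_single hg]
      exact twistPackage_chainVec g (by omega) s

/-! ## The base curve (R-BASE), and N3a from (R-ECURVES) alone -/

/-- **(R-BASE) The base curve**: for `g ≥ 1` the core `b 0` of the charted chain of `page g 1`
(`helper_exists_charted_chain`) is a smoothly embedded curve of `page g 1` with shadow `chainVec g 0`
(`isSmoothEmbedding_core`). [cite: LeeSmoothManifolds2013, Prop. 5.22] -/
theorem exists_embedded_baseCurve (hg : 1 ≤ g) :
    ∃ K₀ : Metric.sphere (0 : EuclideanSpace ℝ (Fin 2)) 1 → Base g,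
      Manifold.IsSmoothEmbedding (𝓡 1) (𝓡∂ 4) ∞ K₀ ∧ (∀ θ, K₀ θ ∈ page g 1) ∧
      ∃ hK₀ : Continuous K₀, shadow g K₀ hK₀ = chainVec g 0 := by
  obtain ⟨b, ψ, hb, hch, hsh, -, -⟩ := helper_exists_charted_chain g 1 norm_one
  have h0 : 0 < 2 * g := by omega
  obtain ⟨h1, h2, h3, h4, h5, h6⟩ := hch ⟨0, h0⟩
  refine ⟨b ⟨0, h0⟩, isSmoothEmbedding_core norm_one h1 h2 h3 h4 h5 h6, fun θ => ?_, hb _, hsh ⟨0, h0⟩⟩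
  rw [← circlePt_angA θ, ← h3]
  exact h4 _

/-- **N3a from (R-ECURVES) alone**: if for every `1 ≤ j < g` there is a charted page curve of
`page g 1` with shadow `±e_j`, then every primitive class is the shadow of a smoothly embedded curve of
every flat open page `page g d`, `‖d‖ = 1`. [cite: FarbMargalit2012, Prop. 6.2] -/
theorem node_STcurve_of_eCurves (g : ℕ)
    (hE : ∀ j : Fin g, 1 ≤ (j : ℕ) →
      ∃ (φ : ℝ × ℝ → Base g) (b : Metric.sphere (0 : EuclideanSpace ℝ (Fin 2)) 1 → Base g)
        (hb : Continuous b), ContMDiff 𝓘(ℝ, ℝ × ℝ) (𝓡∂ 4) ∞ φ ∧ (∀ u r, φ (u + 1, r) = φ (u, r)) ∧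
        (∀ u, φ (u, 0) = b (circlePt u)) ∧ (∀ p, φ p ∈ page g 1) ∧
        InjOn φ (Ico (0 : ℝ) 1 ×ˢ Ioo (-1 : ℝ) 1) ∧
        (∀ u r, r ∈ Ioo (-1 : ℝ) 1 →
          0 < inner ℝ (deriv (fun r' => (φ (u, r')).1) r) (cplxJ (deriv (fun u' => (φ (u', r)).1) u))) ∧
        (shadow g b hb = Pi.single (Sum.inl j) 1 ∨ shadow g b hb = -Pi.single (Sum.inl j) 1))
    {d : ℂ} (hd : ‖d‖ = 1) (v : Fin g ⊕ Fin g → ℤ) (hv : IsPrimitive v) :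
    ∃ K : Metric.sphere (0 : EuclideanSpace ℝ (Fin 2)) 1 → Base g,
      Manifold.IsSmoothEmbedding (𝓡 1) (𝓡∂ 4) ∞ K ∧ (∀ θ, K θ ∈ page g d) ∧
      ∃ hK : Continuous K, shadow g K hK = v := by
  rcases Nat.eq_zero_or_pos g with rfl | hg
  · exact (not_isPrimitive_zero_rank v hv).elim
  · exact stcurve_of_eCurves g hE (exists_embedded_baseCurve hg) hd v hv

/-- **Node N3a for genus one, PROVED**: every primitive class of `ℤ² = H₁(F_{1,1}; ℤ)` is the shadow of
a smoothly embedded curve of every flat open page of `Base 1`. [cite: FarbMargalit2012, Prop. 6.2] -/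
theorem node_STcurve_genus_one (v : Fin 1 ⊕ Fin 1 → ℤ) (hv : IsPrimitive v) {d : ℂ} (hd : ‖d‖ = 1) :
    ∃ K : Metric.sphere (0 : EuclideanSpace ℝ (Fin 2)) 1 → Base 1,
      Manifold.IsSmoothEmbedding (𝓡 1) (𝓡∂ 4) ∞ K ∧ (∀ θ, K θ ∈ page 1 d) ∧
      ∃ hK : Continuous K, shadow 1 K hK = v :=
  node_STcurve_of_eCurves 1 (fun j hj => absurd hj (by have := j.2; omega)) hd v hv

/-! ## The registered forms -/

/-- **Sub-goal `helper_node_STcurve_of_eCurves`** (G6-8, node N3a `node_STcurve` from its one remaining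
geometric input): charted page curves of `page g 1` with shadow `±e_j` for `1 ≤ j < g` give a smoothly
embedded curve in every flat open page `page g d` (`‖d‖ = 1`) in every primitive class.
[cite: FarbMargalit2012, Prop. 6.2] -/
theorem helper_node_STcurve_of_eCurves : ∀ (g : ℕ), (∀ j : Fin g, 1 ≤ (j : ℕ) → ∃ (φ : ℝ × ℝ → Literature.Topology.FourManifolds.LefschetzBase.Base g) (b : Metric.sphere (0 : EuclideanSpace ℝ (Fin 2)) 1 → Literature.Topology.FourManifolds.LefschetzBase.Base g) (hb : Continuous b), ContMDiff 𝓘(ℝ, ℝ × ℝ) (𝓡∂ 4) ∞ φ ∧ (∀ u r, φ (u + 1, r) = φ (u, r)) ∧ (∀ u, φ (u, 0) = b (Literature.Topology.FourManifolds.circlePt u)) ∧ (∀ p, φ p ∈ Literature.Topology.FourManifolds.LefschetzBase.page g 1) ∧ Set.InjOn φ (Set.Ico (0 : ℝ) 1 ×ˢ Set.Ioo (-1 : ℝ) 1) ∧ (∀ u r, r ∈ Set.Ioo (-1 : ℝ) 1 → 0 < inner ℝ (deriv (fun r' => (φ (u, r')).1) r) (Literature.Topology.FourManifolds.LefschetzBase.cplxJ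 (deriv (fun u' => (φ (u', r)).1) u))) ∧ (Literature.Topology.FourManifolds.LefschetzBase.shadow g b hb = Pi.single (Sum.inl j) 1 ∨ Literature.Topology.FourManifolds.LefschetzBase.shadow g b hb = -Pi.single (Sum.inl j) 1)) → ∀ (d : ℂ), ‖d‖ = 1 → ∀ (v : Fin g ⊕ Fin g → ℤ), Literature.GroupTheory.CombinatorialGroupTheory.SignedHurwitz.IsPrimitive v → ∃ K : Metric.sphere (0 : EuclideanSpace ℝ (Fin 2)) 1 → Literature.Topology.FourManifolds.LefschetzBase.Base g, Manifold.IsSmoothEmbedding (𝓡 1) (𝓡∂ 4) ∞ K ∧ (∀ θ, K θ ∈ Literature.Topology.FourManifolds.LefschetzBase.page g d) ∧ ∃ hK : Continuous K, Literature.Topology.FourManifolds.LefschetzBase.shadow g K hK = v :=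
  fun g hE _ hd v hv => node_STcurve_of_eCurves g hE hd v hv

/-- **Sub-goal `helper_node_STcurve_genus_one`** (G6-8, node N3a `node_STcurve` for `g = 1`, PROVED).
[cite: FarbMargalit2012, Prop. 6.2] -/
theorem helper_node_STcurve_genus_one : ∀ (v : Fin 1 ⊕ Fin 1 → ℤ), Literature.GroupTheory.CombinatorialGroupTheory.SignedHurwitz.IsPrimitive v → ∀ (d : ℂ), ‖d‖ = 1 → ∃ K : Metric.sphere (0 : EuclideanSpace ℝ (Fin 2)) 1 → Literature.Topology.FourManifolds.LefschetzBase.Base 1, Manifold.IsSmoothEmbedding (𝓡 1) (𝓡∂ 4) ∞ K ∧ (∀ θ, K θ ∈ Literature.Topology.FourManifolds.LefschetzBase.page 1 d) ∧ ∃ hK : Continuous K, Literature.Topology.FourManifolds.LefschetzBase.shadow 1 K hK = v :=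
  fun v hv _ hd => node_STcurve_genus_one v hv hd

/-- **Sub-goal `helper_STcurve_of_eCurves`** (G6-8, node N3a `node_STcurve` from its two remaining
geometric inputs): charted page curves of `page g 1` with shadow `±e_j` for `1 ≤ j < g` and one smoothly
embedded curve of `page g 1` with shadow `chainVec g 0` give a smoothly embedded curve in every flat
open page `page g d` (`‖d‖ = 1`) in every primitive class. [cite: FarbMargalit2012, Prop. 6.2] -/
theorem helper_STcurve_of_eCurves : ∀ (g : ℕ), (∀ j : Fin g, 1 ≤ (j : ℕ) → ∃ (φ : ℝ × ℝ → Literature.Topology.FourManifolds.LefschetzBase.Base g) (b : Metric.sphere (0 : EuclideanSpace ℝ (Fin 2)) 1 → Literature.Topology.FourManifolds.LefschetzBase.Base g) (hb : Continuous b), ContMDiff 𝓘(ℝ, ℝ × ℝ) (𝓡∂ 4) ∞ φ ∧ (∀ u r, φ (u + 1, r) = φ (u, r)) ∧ (∀ u, φ (u, 0) = b (Literature.Topology.FourManifolds.circlePt u)) ∧ (∀ p, φ p ∈ Literature.Topology.FourManifolds.LefschetzBase.page g 1) ∧ Set.InjOn φ (Set.Ico (0 : ℝ) 1 ×ˢ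 Set.Ioo (-1 : ℝ) 1) ∧ (∀ u r, r ∈ Set.Ioo (-1 : ℝ) 1 → 0 < inner ℝ (deriv (fun r' => (φ (u, r')).1) r) (Literature.Topology.FourManifolds.LefschetzBase.cplxJ (deriv (fun u' => (φ (u', r)).1) u))) ∧ (Literature.Topology.FourManifolds.LefschetzBase.shadow g b hb = Pi.single (Sum.inl j) 1 ∨ Literature.Topology.FourManifolds.LefschetzBase.shadow g b hb = -Pi.single (Sum.inl j) 1)) → (∃ K₀ : Metric.sphere (0 : EuclideanSpace ℝ (Fin 2)) 1 → Literature.Topology.FourManifolds.LefschetzBase.Base g, Manifold.IsSmoothEmbedding (𝓡 1) (𝓡∂ 4) ∞ K₀ ∧ (∀ θ, K₀ θ ∈ Literature.Topology.FourManifolds.LefschetzBase.page g 1) ∧ ∃ hK₀ : Continuous K₀, Literature.Topology.FourManifolds.LefschetzBase.shadow g K₀ hK₀ = Literature.Topology.FourManifolds.LefschetzBase.chainVec g 0) → ∀ (d : ℂ), ‖d‖ = 1 → ∀ (v : Fin g ⊕ Fin g → ℤ), Literature.GroupTheory.CombinatorialGroupTheory.SignedHurwitz.IsPrimitive v → ∃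 K : Metric.sphere (0 : EuclideanSpace ℝ (Fin 2)) 1 → Literature.Topology.FourManifolds.LefschetzBase.Base g, Manifold.IsSmoothEmbedding (𝓡 1) (𝓡∂ 4) ∞ K ∧ (∀ θ, K θ ∈ Literature.Topology.FourManifolds.LefschetzBase.page g d) ∧ ∃ hK : Continuous K, Literature.Topology.FourManifolds.LefschetzBase.shadow g K hK = v :=
  fun g hE hbase _ hd v hv => stcurve_of_eCurves g hE hbase hd v hv

end Summit.SmoothPoincare4.SmoothPoincare4.Theorems.AcyclicBisectionExists.ModpBraidOrbits

end
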